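import Summits.BirchSwinnertonDyer.BirchSwinnertonDyer.Theorems.EisensteinPrimesMazurMCOnCellBTwistbackTwoStepShaUnitLevel
import Summits.BirchSwinnertonDyer.BirchSwinnertonDyer.Theorems.SchneiderFreeAdditiveX3PoitouTateSelmerDualityHolds
import Summits.BirchSwinnertonDyer.BirchSwinnertonDyer.Theorems.SchneiderFreeAdditiveX3PoitouTateShaDualityHolds
import Summits.BirchSwinnertonDyer.BirchSwinnertonDyer.Theorems.EisensteinPrimesMazurMCOnCellBTwistbackUnitEndCell70971a1
import Summits.BirchSwinnertonDyer.BirchSwinnertonDyer.Theorems.Rank2ShaTierKitW16P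
import Summits.BirchSwinnertonDyer.BirchSwinnertonDyer.Theorems.EisensteinPrimesMazurMCOnCellBTwistbackUnitEndP5Cell395c1
import Summits.BirchSwinnertonDyer.BirchSwinnertonDyer.Theorems.EisensteinPrimesMazurMCOnCellBOfNamedFactsV9
import Summits.BirchSwinnertonDyer.BirchSwinnertonDyer.Theorems.EisensteinPrimesMazurMCOnCellBTwistbackDefectSwapUp
import Summits.BirchSwinnertonDyer.Rank1Residual.X1.DoubleTwistDisplayKit
import Summits.BirchSwinnertonDyer.Rank1Residual.X2.RouteGSplitDisplay329718a1Local
import Summits.BirchSwinnertonDyer.Rank1Residual.X2.TwistParityStability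
import Literature.NumberTheory.EllipticCurves.TateCurve.NumberFieldUniformization
import Literature.NumberTheory.EllipticCurves.TateCurve.NumberFieldUniformizationTwisted
import Literature.NumberTheory.EllipticCurves.HeegnerHypothesisKroneckerProofs
import Literature.NumberTheory.EllipticCurves.HeegnerFieldOfDiscriminantProofs
import Literature.NumberTheory.EllipticCurves.ModularityVersionApProofs
import Literature.NumberTheory.EllipticCurves.MazurTorsionGaloisStructureProofs
import Mathlib.Tactic.NormNum.LegendreSymbol
import HarnessLib

/-!
# Crux 3 `MazurMCOnCellB` (stmt-BirchSwinnertonDyer-19033), line `twistback` v12 — DISTANCE-0 DISPLAY at `p = 5` on the SPLIT X2b pair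
# `(10230bh1, 5)`: the class is ITSELF a Ш-unit vertex, so Mazur's main conjecture and `BSD(E,5)` at `10230bh1` follow from PUBLISHED
# inputs only (`PublishedInputs` + Wuthrich 2014 Prop. 21) and TWO Cremona readings; base facts (`X2.CellB` at `5`) in the kernel

Width seat bsd-line-x2-p1-w5 (g5), cell `bsd-eis`, 2026-08-29; `--supports stmt-BirchSwinnertonDyer-19033 --as helper`. THEOREMS ONLY.
Format (Z) of this seat's `…TwistbackShaUnitVertexDisplays01/02` (legend there) for a cell with NO distance-2 display in the tree:
WHAT. `10230bh1 = [1, 0, 0, -385, 5225]` (Cremona `allbsd`: `r = 0`, `#T = 5`, `∏c = 125`, `Ω = 1.18165419`, `L(E,1) = 5.90827093`, `#Ш_an = 1` — a `5`-adic Ш-UNIT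
class): `N = 10230 = 2·3·5·11·31` (semistable; `|Δ| = 2⁵·3⁵·5⁵·11·31`, `c₄ = 18481` prime to `Δ`), SPLIT multiplicative at `5` (node-tangent root `t = 0` mod `5`),
rational point `T = (−10, −85)` of ORDER `5` (`2T = (20, 65)`, `4T = −T`; `Rank2Sha.fiveTorsCheck`), hence `E[5]` reducible and `¬ GVPar (E, 5)`; `c₂ = c₃ = c₅ = 5`, `c₁₁ = c₃₁ = 1`.
This cell gets its FIRST display in format (Z) because it has no admissible two-step pair with `|d| < 4000` (five bad primes, `2 ∣ N`); at distance 0 no twist and no field is needed.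
HYPOTHESES LEFT, BY NAME: `PublishedInputs` (item 19037, PUBLISHED), `sha_dvd_analyticSha` (Wuthrich 2014 Prop. 21, PUBLISHED) — nothing
else (no Keller–Yin, no Hsieh / LZZ / Mazur 4.1 / Poitou–Tate) — and TWO readings `hr` (`r_an = 0`), `hunit` (`#Ш_an(10230bh1) = 1`, Cremona).
HONEST FRAMING: nothing is booked; `(10230bh1, 5)` is NOT closed by this file (readings are not theorems); Mazur's main conjecture / BSD is
proved for NO curve unconditionally; no summit statement is proved; closes no registered stub; 0 cells / labels / stubs / tiers move.
References: [Wuthrich2014] Prop. 21, Thm. 16; [SteinWuthrich2013] Thm. 6.1; [GreenbergVatsal2000] (1.3); [SilvermanATAEC1994] V.5.3–5.4;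
[SilvermanAEC2009] III.2.3, VII.1, VII.5; [MilneADT2006] I.7.3; [Miller2011LMS] Def. 1.1; [Mazur1977] III.5; Cremona allbsd.
-/
set_option autoImplicit false
-- `Summit.BirchSwinnertonDyer.BirchSwinnertonDyer.…`: the summit and its single sub-problem share a name.
set_option linter.dupNamespace false
noncomputable section
open scoped Classical
open WeierstrassCurve NumberField IsDedekindDomain Literature.NumberTheory.EllipticCurves
  Literature.NumberTheory.EllipticCurves.ModularForms Literature.NumberTheory.EllipticCurves.Rank1Residual
  Literature.NumberTheory.EllipticCurves.Rank1Residual.Typed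
  Literature.NumberTheory.EllipticCurves.Rank1Residual.X11RankOneCertificates
  Literature.NumberTheory.EllipticCurves.Wuthrich2014 Literature.NumberTheory.EllipticCurves.KellerYin2024
  Literature.NumberTheory.EllipticCurves.TateCurve Literature.NumberTheory.GaloisCohomology
  Summit.BirchSwinnertonDyer.BirchSwinnertonDyer.Rank1Residual.IntModel
  Summit.BirchSwinnertonDyer.BirchSwinnertonDyer.Rank1Residual.X11RankOne
  Summit.BirchSwinnertonDyer.Rank1Residual.X11b Summit.BirchSwinnertonDyer.Rank1Residual
  Summit.BirchSwinnertonDyer.Rank1Residual.X2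
  Summit.BirchSwinnertonDyer.Rank1Residual.X2.RouteGSplitDisplay329718a1Local
  Summit.BirchSwinnertonDyer.BirchSwinnertonDyer.Theses Summit.BirchSwinnertonDyer.BirchSwinnertonDyer.Theorems
  Summit.BirchSwinnertonDyer.BirchSwinnertonDyer.Theorems.EisensteinPrimesMazurMCOnCellBTwistbackTwoStepShaUnit
  Summit.BirchSwinnertonDyer.BirchSwinnertonDyer.Theorems.EisensteinPrimesMazurMCOnCellBTwistbackTwoStepShaUnitLevel
  Summit.BirchSwinnertonDyer.BirchSwinnertonDyer.Theorems.EisensteinPrimesMazurMCOnCellBTwistbackTwoStepDefs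

namespace Summit.BirchSwinnertonDyer.BirchSwinnertonDyer.Theorems.EisensteinPrimesMazurMCOnCellBTwistbackShaUnitVertexP5Cell10230bh1
/-! ## §1 The base pair `(10230bh1, 5)`: split at `5`, the rational point of order `5`, `E[5]` reducible, `¬ GVPar`, `X2.CellB` -/

/-- `10230bh1 = [1, 0, 0, -385, 5225]` is elliptic (`|Δ| = 2⁵·3⁵·5⁵·11·31 ≠ 0`). [folklore] -/
theorem isElliptic_10230bh1 : (⟨1, 0, 0, -385, 5225⟩ : WeierstrassCurve ℚ).IsElliptic :=
  isElliptic_of_discOf_ne_zero 1 0 0 (-385) 5225 (by decide +kernel)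

set_option maxRecDepth 100000 in
/-- `10230bh1` is globally minimal (support-form Kraus–Silverman criterion on `|Δ| = 2⁵·3⁵·5⁵·11·31`).
[cite: SilvermanAEC2009, VII.1 Remark 1.1] [cite: Kraus1989, Prop. 1 and Prop. 2] -/
theorem isGloballyMinimal_10230bh1 : (⟨1, 0, 0, -385, 5225⟩ : WeierstrassCurve ℚ).IsGloballyMinimal :=
  X11b.isGloballyMinimal_of_krausCriterion_support 1 0 0 (-385) 5225
    [(2, 1, 5), (3, 1, 5), (5, 1, 5), (11, 1, 1), (31, 1, 1)] (by intro t ht; fin_cases ht <;> norm_num)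
    (by decide +kernel) (by decide +kernel)

/-- **`10230bh1` is SPLIT multiplicative at `5`** (`5 ∣ Δ`, `5 ∤ c₄ = 18481`; node-tangent root `t = 0` mod `5`).
[cite: SilvermanAEC2009, VII.5 Prop. 5.1(b)] -/
theorem split_10230bh1 : (⟨1, 0, 0, -385, 5225⟩ : WeierstrassCurve ℚ).HasSplitMultiplicativeReductionAtPrime 5 := by
  haveI := isElliptic_10230bh1
  haveI := isGloballyMinimal_10230bh1
  have hI := integralModelInt_eq_of_map_eq (W := (⟨1, 0, 0, -385, 5225⟩ : WeierstrassCurve ℚ)) _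
    (map_mk_int 1 0 0 (-385) 5225)
  refine hasSplitMultiplicativeReductionAtPrime_of_intModel_of_root hI 5
    (by rw [intCurve_Δ]; decide +kernel) (by rw [intCurve_c₄]; decide +kernel) ⟨0, ?_⟩
  simp only [WeierstrassCurve.c₄, WeierstrassCurve.b₂, WeierstrassCurve.b₄, WeierstrassCurve.b₆]
  push_cast
  decide

/-- **A rational point of ORDER `5` on `10230bh1` — IN THE KERNEL**: `T = (-10, -85)`, `2T = (20, 65)`, `2T + 2T = (-10, 95) = −T`
(cell b2b-bsdr2sha's tangent certificates `Rank2Sha.fiveTorsCheck`, decided on the integer model; transport lemma of the 395c1 file; no torsion theorem named).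
[cite: SilvermanAEC2009, III.2.3] -/
theorem exists_addOrderOf_eq_five_10230bh1 : ∃ T : (⟨1, 0, 0, -385, 5225⟩ : WeierstrassCurve ℚ).toAffine.Point, addOrderOf T = 5 := by
  have hΔ : (⟨1, 0, 0, -385, 5225⟩ : WeierstrassCurve ℤ).Δ ≠ 0 := by rw [intCurve_Δ]; decide +kernel
  have h5 : Rank2Sha.fiveTorsCheck (⟨1, 0, 0, -385, 5225⟩ : WeierstrassCurve ℤ) (-10) (-85) 20 65 = true := by
    decide +kernel
  exact EisensteinPrimesMazurMCOnCellBTwistbackUnitEndP5Cell395c1.exists_addOrderOf_eq_of_curve_eq (map_mk_int 1 0 0 (-385) 5225)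
    (Rank2Sha.exists_addOrderOf_eq_five_of_fiveTorsCheck hΔ h5)

/-- **`10230bh1[5]` is reducible — IN THE KERNEL** (a rational point of order `5` spans a Galois-stable line; Mazur's torsion–Galois
structure lemma of the tree, no named fact). [cite: Mazur1977, Ch. III §5, p. 157] -/
theorem not_irreducible_10230bh1 : ¬ (⟨1, 0, 0, -385, 5225⟩ : WeierstrassCurve ℚ).HasIrreducibleModPGaloisRep 5 := by
  haveI := isElliptic_10230bh1
  obtain ⟨T, hT⟩ := exists_addOrderOf_eq_five_10230bh1
  exact not_hasIrreducibleModPGaloisRep_of_addOrderOf_eq _ hT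

/-- **`¬ GVPar (10230bh1) 5` IN THE KERNEL**: the rational `5`-torsion point spans a rational line that is unramified at `5` and
even, hence of co-type, and at the odd SPLIT multiplicative prime `5` one co-type line forces type A
(`X2.not_gvPar_of_nsmul_eq_zero_of_mult`, Tate uniformisation `hT`, `hT'`; same shape as the `p = 3` displays).
[cite: GreenbergVatsal2000, Thm. (1.3) and §2 p. 28] [cite: SilvermanATAEC1994, Thm. V.5.3 and Cor. V.5.4] -/
theorem not_gvPar_10230bh1
    (hT : Silverman1994_thmV53_corV54_tateUniformisation.{0})
    (hT' : Silverman1994_thmV53_tateUniformisation.{0}) :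
    ¬ GVPar (⟨1, 0, 0, -385, 5225⟩ : WeierstrassCurve ℚ) 5 := by
  haveI := isElliptic_10230bh1
  haveI := isGloballyMinimal_10230bh1
  obtain ⟨T, hT5⟩ := exists_addOrderOf_eq_five_10230bh1
  have h5 : (5 : ℕ) • T = 0 := hT5 ▸ addOrderOf_nsmul_eq_zero T
  have h0 : T ≠ 0 := by
    rintro rfl
    rw [addOrderOf_zero] at hT5
    exact absurd hT5 (by norm_num)
  exact not_gvPar_of_nsmul_eq_zero_of_mult _ hT' hT (by decide) split_10230bh1.hasMultiplicativeReductionAtPrime _ h0 h5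

/-- **`X2.CellB (10230bh1) 5` from the rank reading alone**: `5 ≠ 2`, `E[5]` reducible (`not_irreducible_10230bh1`), `5` multiplicative
(`split_10230bh1`), `¬ GVPar` (`not_gvPar_10230bh1`, the Tate-uniformisation facts discharged by the tree's `_holds` theorems).
[cite: GreenbergVatsal2000, Thm. (1.3) and §2 p. 28] [cite: SilvermanATAEC1994, Thm. V.5.3 and Cor. V.5.4] -/
theorem cellB_10230bh1_of_analyticRank
    (hr : (⟨1, 0, 0, -385, 5225⟩ : WeierstrassCurve ℚ).analyticRank = 0) :
    X2.CellB (⟨1, 0, 0, -385, 5225⟩ : WeierstrassCurve ℚ) 5 :=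
  ⟨hr, ⟨by decide, not_irreducible_10230bh1, split_10230bh1.hasMultiplicativeReductionAtPrime⟩,
    not_gvPar_10230bh1 Silverman1994_thmV53_corV54_tateUniformisation_holds
      Silverman1994_thmV53_tateUniformisation_holds⟩

/-! ## §Z The display at distance 0: `(10230bh1, 5)` is itself a Ш-unit vertex -/

-- 6⁷'s LEFT disjunct at `(10230bh1, 5)` at distance 0 is the curve-independent landed lemma
-- `…ShaUnitVertexDisplays01.connectedClassShaUnit_395c1_refl` (p698143), applied to `W`, `hunit`; not restated.

/-- **Mazur's main conjecture at `(10230bh1, 5)` from PUBLISHED inputs only + two Cremona readings** (`hr`: `r_an = 0`, `L(E,1) = 5.90827093`;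
`hunit`: `#Ш_an = 1`): `cellB_10230bh1_of_analyticRank`, the class's own unit member (identity isogeny),
`…OfNamedFactsV9.mazurMainConjectureAt_of_namedFacts_of_classShaUnit` (Wuthrich Prop. 21 + GZK, Cassels, `X2.mazurMainConjectureAt_of_bsdp_of_red`).
Cone: `PublishedInputs`, `sha_dvd_analyticSha` — both PUBLISHED. CONDITIONAL; nothing booked.
[cite: Wuthrich2014, Prop. 21 (p. 400) and Thm. 16 (p. 397)] [cite: MilneADT2006, Thm. I.7.3] [cite: Miller2011LMS, Def. 1.1] -/
theorem mazurMainConjectureAt_10230bh1_at_five_of_shaUnit (hP : EisensteinPrimes.PublishedInputs) (hW21 : sha_dvd_analyticSha)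
    (W : WeierstrassCurve ℚ) [W.IsElliptic] [W.IsGloballyMinimal] (hW : W = ⟨1, 0, 0, -385, 5225⟩) (hr : W.analyticRank = 0)
    (hunit : ∃ q : ℚ, shaAn W = (q : ℂ) ∧ padicValRat 5 q = 0) : X2.MazurMainConjectureAt W 5 := by
  subst hW
  exact EisensteinPrimesMazurMCOnCellBOfNamedFactsV9.mazurMainConjectureAt_of_namedFacts_of_classShaUnit hP hW21 _ 5
    (cellB_10230bh1_of_analyticRank hr) ⟨_, inferInstance, inferInstance, WeierstrassCurve.isIsogenous_self _, hunit⟩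

/-- **`BSD(E, 5)` at `10230bh1` from PUBLISHED inputs only + the same two readings** (`…DefectSwapUp.bsdp_of_cellB_of_classShaUnit`:
Wuthrich Prop. 21 + GZK at the unit member, Cassels). CONDITIONAL; nothing booked.
[cite: Wuthrich2014, Prop. 21 (p. 400)] [cite: MilneADT2006, Thm. I.7.3] [cite: Miller2011LMS, Def. 1.1] -/
theorem bsdp_10230bh1_at_five_of_shaUnit (hP : EisensteinPrimes.PublishedInputs) (hW21 : sha_dvd_analyticSha)
    (W : WeierstrassCurve ℚ) [W.IsElliptic] [W.IsGloballyMinimal] (hW : W = ⟨1, 0, 0, -385, 5225⟩) (hr : W.analyticRank = 0)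
    (hunit : ∃ q : ℚ, shaAn W = (q : ℂ) ∧ padicValRat 5 q = 0) : BSDp W 5 := by
  subst hW
  exact EisensteinPrimesMazurMCOnCellBTwistbackDefectSwapUp.bsdp_of_cellB_of_classShaUnit hP hW21 _ 5
    (cellB_10230bh1_of_analyticRank hr) ⟨_, inferInstance, inferInstance, WeierstrassCurve.isIsogenous_self _, hunit⟩

end Summit.BirchSwinnertonDyer.BirchSwinnertonDyer.Theorems.EisensteinPrimesMazurMCOnCellBTwistbackShaUnitVertexP5Cell10230bh1
end
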